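import Summits.QuantumFields.YangMills.Theorems.UnitScaleTiltHalvingP1FlatCoreJunction
import Summits.QuantumFields.YangMills.Theorems.UnitScaleTiltHalvingP1FlatCoreDP1OfTop
import HarnessLib

/-!
# `hP1room` PROGRAMME (LEAD-H «H = hP1room» BOARD v1, RULING L-9 (1)), (A-1) STAGE 1: ★★★ THE PER-SITE DOOR — THE `log`-CHART DATA IN THE MULTIPLIER CURRENCY
# FROM THE THREE POINTWISE SUPPLIERS (R1) JUNCTION, (R2) MULTIPLIER FORM, (R3) D-P1 CLAUSE FROM THE TOP STEP

Route `UnitScaleTilt`, crux K1 child «MinimiserStabilityRegPr» (stmt-QuantumFields-19200), registered stub `stub_halvingStep` (`BirthV10`), text `hP1room`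
(per site: the `hJ4mult` ∃-text of ✓`HalvingP1FlatCoreExtractionMult.p1FlatPillar'_room_of_mlogChartDataMult`).

At ONE member∕site `(F, n < K, x₀)` with the route cube data `(ρ, S, M, hM)` and J1b's window letters `(a, M′, ρ′)` (`h0 h1 ha hroom`), given
* [N05 ∕ J3 side, on `ℤ³`] an `SU(2)` gauge `w`, a one-form `X`, the restriction tower `Λs`, the Landau multiplier `μ`, with the chart rows `hWnear`∕`hX` at `η := L^{−(K−n)}`, the flat
  Landau window `hLan`, the tower exclusion `hΛ` below the window and the top-box inclusion `hΛtop`;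
* [top step (c)] the effective-gauge frames `g h′ κ′ ν gs` with their recursions, the composite-gauge identity `hug` and the top identity `htop` on `Λs (K−n)`;
* [sizes] the two (1.36)♭ rows (iii) for the torus one-form `A := X ∘ rep` (`0` off the window bonds) in `IsLevWeight` letters (displayed; (R4) supplies them);
the torus gauge `u := w ∘ rep` and `A` satisfy the SIX per-site rows (o) `DP1Clause`, near-identity, `log`-chart, `A = 0` off the window, (iii), (iv) multiplier form — by
✓`HalvingP1FlatCoreDP1OfTop.dp1Clause_of_top_junction` (o), ✓`HalvingP1FlatCoreJunction.junction_chart` (near∕chart∕off), ✓`junction_hpt` +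
✓`HalvingP1FlatCoreTransportAssembly.multiplierForm_of_flatLandau_window` (iv) with the `η` bridge `((L⁻¹)^k)⁻¹ = L^k` (A1-LOCATE F2).  Pure plumbing; it FIXES the letters
the J suppliers conclude.  ★★★ `mlogChartDataMult_of_suppliers` keeps `Λs` abstract; ★★★ `mlogChartDataMult_of_suppliers_cubeLamS` specialises it to N05's restriction tower
`cubeLamS L a M′ ρ′ k k` (★w7-19936 g5 «ONE object»), where `hΛtop` is `B8CubeMemberZd.cubeLamS_self` and `hΛ` is ✓`flm_not_mem_cubeLam_of_mem_cube` through `cubeLamS_top`.  `--supports stmt-QuantumFields-19200 --as helper`.  Rung R3 of the ladder (YM₃ on T³ after Bałaban), NOT the Clay problem; no stub∕crux is claimed.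

References: T. Bałaban, CMP **99** (1985) 75–102 [Balaban1985RegularSpaces] (Thm 2 p.83, (1.36)–(1.38) p.82, (1.91) p.98); CMP **102** (1985) 277–309
[Balaban1985Variational] ((150)–(156) pp.301–302); CMP **98** (1985) 17–51 [Balaban1985Averaging] ((8) p.19, (92) p.31).
-/

set_option autoImplicit false

noncomputable section

open scoped BigOperators Matrix.Norms.L2Operator

namespace Summit.QuantumFields.YangMills.Theorems.HalvingP1FlatCoreChartDataDoor

open Literature.MathematicalPhysics.QuantumFieldTheory.Balaban1983to89
open Literature.MathematicalPhysics.QuantumFieldTheory.Balaban1983to89.T3ContinuumYM3Torus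
open T4Continuum BlockAveraging ExpMeanLog T3RegularMinimiser
open Complex (I)
open MatrixLog (mlog)
open B5Eq118OneStroke (iterBlockOf)
open B6SectAOperatorsV1 (SiteIdx)
open B7Prop1Explicit renaming Site → LSite
open B7Prop1Explicit (e)
open B7Prop1Local (InBox)
open B8Eq131Cubes (cube flm gs sqLo sqHi)
open B8Eq138LandauZd (covDivB covLap QT)
open B10Eq27TorusAxialLog (transl rel unitsField toUField suIncl gaugeActT axialT)
open B15Eq112TorusCover (lift)
open Node00 (coverAt)
open LatticeFieldCalculus (laplace diverg siteAvgIter)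
open FlatCubeOpsText (IsLevWeight)
open FlatCubeSequenceAligned (cubeSeqMT3 cubeSetM)
open Summit.QuantumFields.YangMills.Theorems.Prop8ChartDoubleBar (dbarIterU vframeU)
open HalvingP1FlatPillar (DP1Clause)
open HalvingP1FlatCoreJunction (junction_hpt junction_chart)
open HalvingP1FlatCoreTransportAssembly (multiplierForm_of_flatLandau_window)
open HalvingP1FlatCoreDP1OfTop (dp1Clause_of_top_junction)
open HalvingP1FlatCoreTransportZd (flm_not_mem_cubeLam_of_mem_cube)
open B8CubeMemberZd (cubeLamS cubeLam cubeLamS_self cubeLamS_top)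

variable {F : T3Family} {n K : ℕ}

open Classical in
/-- ★★★ **THE PER-SITE DOOR OF (A-1): `log`-CHART DATA IN THE MULTIPLIER CURRENCY FROM THE THREE POINTWISE SUPPLIERS.**  Conclusion = the per-site ∃-text `hJ4mult` of
✓`HalvingP1FlatCoreExtractionMult.p1FlatPillar'_room_of_mlogChartDataMult` at `D := cubeSeqMT3 F n K x₀ ρ S M hM`, `Ω₀ := cubeSetM x₀ (K−n) ρ S M 0`, witnessed by
`u := w ∘ rep` and `A := X ∘ rep` (`0` off the window bonds); hypotheses = the non-generic inputs of (R1)–(R3), displayed verbatim and grouped by source.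
[cite: Balaban1985RegularSpaces, Thm 2 p.83, (1.36)-(1.38) p.82; Balaban1985Variational, (150)-(156) pp.301-302; Balaban1985Averaging, (8) p.19, (92) p.31] -/
theorem mlogChartDataMult_of_suppliers (hnK : n < K) (x₀ : Site (F.P K) 0) (ρ S M Nr : ℕ) (hM : 1 ≤ M) (hS : 2 ≤ S) (hNr : M ≤ Nr)
    (hroom : 2 * ρ + Nr ≤ F.L ^ (F.m + n))
    -- J1b's window letters
    {a : LSite (F.P K).d} {M' ρ' : ℕ} (hρ' : 2 ≤ ρ') (h0 : ρ + M ≤ ρ' + 1) (h1 : (F.P K).L + S + M ≤ ρ' + 2)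
    (ha : ∀ ν, a ν ≤ ((iterBlockOf (K - n) x₀ ν).val : ℤ) ∧ ((iterBlockOf (K - n) x₀ ν).val : ℤ) ≤ a ν + M' - 1)
    (hroomW : 2 * ((F.P K).L ^ (K - n) * (M' + 1) + ρ' * gs (F.P K).L (K - n)) ≤ (F.P K).sitesPerDir 0)
    -- the member field and its regularity
    (U : GaugeField (F.P K) 0 (Matrix.specialUnitaryGroup (Fin 2) ℂ)) {ε₀ B₁ : ℝ} (hε₀ : 0 < ε₀) (hε : 10 ^ 7 * (F.L : ℝ) ^ 3 * ε₀ ≤ 1)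
    (hU : PlaqSmall (regThreshold F n K ε₀) U)
    -- [N05 ∕ J3 side] the ℤ³ gauge, one-form, restriction tower and multiplier
    (w : LSite (F.P K).d → Matrix.specialUnitaryGroup (Fin 2) ℂ) (X : LSite (F.P K).d → Fin (F.P K).d → Matrix (Fin 2) (Fin 2) ℂ)
    (Λs : ℕ → Set (LSite (F.P K).d)) (μ : ℕ → LSite (F.P K).d → Matrix (Fin 2) (Fin 2) ℂ)
    (hWnear : ∀ z ∈ cube (F.P K).L a M' ρ' (K - n) 0, ∀ ν : Fin (F.P K).d,
      transl (0 : Site (F.P K) 0) z ∈ cubeSetM x₀ (K - n) ρ S M 0 → (transl (0 : Site (F.P K) 0) z).shift ν ∈ cubeSetM x₀ (K - n) ρ S M 0 →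
      ‖(((Unitary.toUnits (suIncl (w z)))⁻¹ * unitsField (toUField U) ⟨transl 0 z, ν⟩ * Unitary.toUnits (suIncl (w (z + e ν))) :
          (Matrix (Fin 2) (Fin 2) ℂ)ˣ) : Matrix (Fin 2) (Fin 2) ℂ) - 1‖ ≤ 1 / 4)
    (hX : ∀ z ∈ cube (F.P K).L a M' ρ' (K - n) 0, ∀ ν : Fin (F.P K).d,
      transl (0 : Site (F.P K) 0) z ∈ cubeSetM x₀ (K - n) ρ S M 0 → (transl (0 : Site (F.P K) 0) z).shift ν ∈ cubeSetM x₀ (K - n) ρ S M 0 →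
      I • ((((F.L : ℝ)⁻¹) ^ (K - n)) • X z ν) = mlog (((Unitary.toUnits (suIncl (w z)))⁻¹ * unitsField (toUField U) ⟨transl 0 z, ν⟩ *
          Unitary.toUnits (suIncl (w (z + e ν))) : (Matrix (Fin 2) (Fin 2) ℂ)ˣ) : Matrix (Fin 2) (Fin 2) ℂ))
    (hLan : ∀ z ∈ cube (F.P K).L a M' ρ' (K - n) 0,
      covLap (((F.L : ℝ)⁻¹) ^ (K - n)) (1 : LSite (F.P K).d → Fin (F.P K).d → (Matrix (Fin 2) (Fin 2) ℂ)ˣ)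
          ((cube (F.P K).L a M' ρ' (K - n) 0).indicator
            (covDivB (((F.L : ℝ)⁻¹) ^ (K - n)) (1 : LSite (F.P K).d → Fin (F.P K).d → (Matrix (Fin 2) (Fin 2) ℂ)ˣ) X)) z =
        QT (F.P K).L (K - n) Λs (1 : LSite (F.P K).d → Fin (F.P K).d → (Matrix (Fin 2) (Fin 2) ℂ)ˣ) μ z)
    (hΛ : ∀ j, 1 ≤ j → j ≤ K - n → ∀ j', j' < j → ∀ z ∈ cube (F.P K).L a M' ρ' (K - n) j, flm (F.P K).L j' z ∉ Λs j')
    (hΛtop : ∀ yc : LSite (F.P K).d,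
      InBox (sqLo (F.P K).L a ρ' (K - n) (K - n)) (sqHi (F.P K).L a M' ρ' (K - n) (K - n)) yc → yc ∈ Λs (K - n))
    -- [top step (c)] the effective-gauge frames of the charted iterate, the composite-gauge identity, the top identity
    (g h' : GaugeTransf (F.P K) 0 (Matrix (Fin 2) (Fin 2) ℂ)ˣ)
    (κ' : (i : ℕ) → GaugeTransf (F.P K) i (Matrix (Fin 2) (Fin 2) ℂ)ˣ) (h0' : κ' 0 = h')
    (hs' : ∀ (i : ℕ) (y : Site (F.P K) (i + 1)),
      κ' (i + 1) y = (vframeU (gaugeActT (κ' i) (dbarIterU i (gaugeActT g (unitsField (toUField U))))) y)⁻¹ * κ' i (emb y) *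
        vframeU (dbarIterU i (gaugeActT g (unitsField (toUField U)))) y)
    (ν : (i : ℕ) → Site (F.P K) i → (Matrix (Fin 2) (Fin 2) ℂ)ˣ) (hν0 : ∀ s, ν 0 s = 1)
    (hνs : ∀ (i : ℕ) (y : Site (F.P K) (i + 1)),
      ν (i + 1) y = ν i (emb y) * vframeU (dbarIterU i (gaugeActT g (unitsField (toUField U)))) y)
    (gs' : (i : ℕ) → GaugeTransf (F.P K) i (Matrix (Fin 2) (Fin 2) ℂ)ˣ) (hg0 : gs' 0 = g)
    (hgs : ∀ (i : ℕ) (y : Site (F.P K) (i + 1)), gs' (i + 1) y = gs' i (emb y))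
    (hug : ∀ s, (Unitary.toUnits (suIncl (w (lift (F.P K) x₀ + rel x₀ s))))⁻¹ =
      ((gs' (K - n) (iterBlockOf (K - n) x₀))⁻¹ * ν (K - n) (iterBlockOf (K - n) x₀)) * h' s * g s)
    (htop : ∀ yc ∈ Λs (K - n),
      κ' (K - n) (coverAt (F.P K) (K - n) yc) =
        axialT (dbarIterU (K - n) (gaugeActT g (unitsField (toUField U)))) (iterBlockOf (K - n) x₀) (coverAt (F.P K) (K - n) yc))
    -- [sizes] the two (1.36)♭ rows for `A := X ∘ rep` in `IsLevWeight` letters ((R4) supplies them)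
    (hsize : ∀ wt : ℕ → PBond (F.P K) 0 → ℝ, IsLevWeight F n K (cubeSeqMT3 F n K x₀ ρ S M hM) wt →
      (∀ b : PBond (F.P K) 0, wt 1 b *
        ‖(fun b : PBond (F.P K) 0 => if b.src ∈ cubeSetM x₀ (K - n) ρ S M 0 ∧ b.tgt ∈ cubeSetM x₀ (K - n) ρ S M 0 then
          X (lift (F.P K) x₀ + rel x₀ b.src) b.dir else 0) b‖ ≤ B₁ * ε₀) ∧
      (∀ (b : PBond (F.P K) 0) (ν' : Fin (F.P K).d), wt 2 b * (F.L : ℝ) ^ (K - n) *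
        ‖(fun b : PBond (F.P K) 0 => if b.src ∈ cubeSetM x₀ (K - n) ρ S M 0 ∧ b.tgt ∈ cubeSetM x₀ (K - n) ρ S M 0 then
            X (lift (F.P K) x₀ + rel x₀ b.src) b.dir else 0) ⟨b.src.shift ν', b.dir⟩ -
          (fun b : PBond (F.P K) 0 => if b.src ∈ cubeSetM x₀ (K - n) ρ S M 0 ∧ b.tgt ∈ cubeSetM x₀ (K - n) ρ S M 0 then
            X (lift (F.P K) x₀ + rel x₀ b.src) b.dir else 0) b‖ ≤ B₁ * ε₀)) :
    ∃ (u : GaugeTransf (F.P K) 0 (Matrix.specialUnitaryGroup (Fin 2) ℂ)) (A : PBond (F.P K) 0 → Matrix (Fin 2) (Fin 2) ℂ),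
      DP1Clause F n K (cubeSeqMT3 F n K x₀ ρ S M hM) x₀ U (fun s => suIncl (u s)) ∧
      (∀ (z : LSite (F.P K).d) (μ : Fin (F.P K).d), transl (0 : Site (F.P K) 0) z ∈ cubeSetM x₀ (K - n) ρ S M 0 →
        (transl (0 : Site (F.P K) 0) z).shift μ ∈ cubeSetM x₀ (K - n) ρ S M 0 →
        ‖(((Unitary.toUnits (suIncl (u (transl 0 z))))⁻¹ * unitsField (toUField U) ⟨transl 0 z, μ⟩ *
            Unitary.toUnits (suIncl (u ((transl 0 z).shift μ))) : (Matrix (Fin 2) (Fin 2) ℂ)ˣ) : Matrix (Fin 2) (Fin 2) ℂ) - 1‖ ≤ 1 / 4) ∧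
      (∀ (z : LSite (F.P K).d) (μ : Fin (F.P K).d), transl (0 : Site (F.P K) 0) z ∈ cubeSetM x₀ (K - n) ρ S M 0 →
        (transl (0 : Site (F.P K) 0) z).shift μ ∈ cubeSetM x₀ (K - n) ρ S M 0 →
        I • ((((F.L : ℝ)⁻¹) ^ (K - n)) • A ⟨transl 0 z, μ⟩) =
          mlog (((Unitary.toUnits (suIncl (u (transl 0 z))))⁻¹ * unitsField (toUField U) ⟨transl 0 z, μ⟩ *
            Unitary.toUnits (suIncl (u ((transl 0 z).shift μ))) : (Matrix (Fin 2) (Fin 2) ℂ)ˣ) : Matrix (Fin 2) (Fin 2) ℂ)) ∧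
      (∀ b : PBond (F.P K) 0, ¬ (∃ z : LSite (F.P K).d, transl (0 : Site (F.P K) 0) z ∈ cubeSetM x₀ (K - n) ρ S M 0 ∧
        (transl (0 : Site (F.P K) 0) z).shift b.dir ∈ cubeSetM x₀ (K - n) ρ S M 0 ∧ b = ⟨transl 0 z, b.dir⟩) → A b = 0) ∧
      (∀ wt : ℕ → PBond (F.P K) 0 → ℝ, IsLevWeight F n K (cubeSeqMT3 F n K x₀ ρ S M hM) wt →
        (∀ b : PBond (F.P K) 0, wt 1 b * ‖A b‖ ≤ B₁ * ε₀) ∧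
        (∀ (b : PBond (F.P K) 0) (ν' : Fin (F.P K).d), wt 2 b * (F.L : ℝ) ^ (K - n) * ‖A ⟨b.src.shift ν', b.dir⟩ - A b‖ ≤ B₁ * ε₀)) ∧
      (∃ μ' : SiteIdx (cubeSeqMT3 F n K x₀ ρ S M hM) → Matrix (Fin 2) (Fin 2) ℂ, ∀ s : Site (F.P K) 0,
        laplace ((F.L : ℝ) ^ (K - n)) (diverg ((F.L : ℝ) ^ (K - n)) A) s =
          ∑ i : SiteIdx (cubeSeqMT3 F n K x₀ ρ S M hM), siteAvgIter (i.1.1 : ℕ) (Pi.single s (1 : ℝ)) i.1.2 • μ' i) := by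
  -- the common torus one-form (A1-LOCATE F3)
  set A : PBond (F.P K) 0 → Matrix (Fin 2) (Fin 2) ℂ := fun b =>
    if b.src ∈ cubeSetM x₀ (K - n) ρ S M 0 ∧ b.tgt ∈ cubeSetM x₀ (K - n) ρ S M 0 then X (lift (F.P K) x₀ + rel x₀ b.src) b.dir else 0 with hAdef
  -- (R1) the junction rows
  obtain ⟨hnear, hchart, hA0⟩ := junction_chart x₀ ρ S M hM h0 h1 ha hroomW U w X (((F.L : ℝ)⁻¹) ^ (K - n)) hWnear hX
  have hpt := junction_hpt x₀ ρ S M hM h0 h1 ha hroomW X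
  -- (R3) the D-P1 clause from the top identity
  have ho := dp1Clause_of_top_junction F n K hnK x₀ (S := S) hM hNr hroom h0 ha Λs hΛtop U w g h' κ' h0' hs' ν hν0 hνs gs' hg0 hgs hε₀ hε hU hug htop
  -- (R2) the multiplier form, `η := L^{−(K−n)}`, then `η⁻¹ = L^{K−n}`
  obtain ⟨μ', hμ'⟩ := multiplierForm_of_flatLandau_window hnK x₀ ρ S M hM hS hρ' h0 h1 ha hroomW Λs hΛ (((F.L : ℝ)⁻¹) ^ (K - n)) A X μ hLan hpt
  refine ⟨fun s => w (lift (F.P K) x₀ + rel x₀ s), A, ho, hnear, hchart, hA0, hsize, μ', fun s => ?_⟩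
  have h := hμ' s
  rwa [inv_pow, inv_inv] at h


open Classical in
/-- ★★★ **THE PER-SITE DOOR AT N05's RESTRICTION TOWER `Λs := cubeLamS L a M′ ρ′ k k`** (★w7-19936 g5 13:39:38Z «ONE object»): the same door with the restriction
tower SPECIALISED to N05's full k-level member's `cubeLamS (F.P K).L a M′ ρ′ (K−n) (K−n)` — then (R3)'s top-box inclusion is `cubeLamS_self` (the top box IS `Λs k`) and
(R2)'s tower exclusion is ✓`HalvingP1FlatCoreTransportZd.flm_not_mem_cubeLam_of_mem_cube` through `cubeLamS_top`; two displayed hypotheses fewer.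
[cite: Balaban1985RegularSpaces, Thm 2 p.83, (1.36)-(1.38) p.82, (1.91) p.98; Balaban1985Variational, (150)-(156) pp.301-302] -/
theorem mlogChartDataMult_of_suppliers_cubeLamS (hnK : n < K) (x₀ : Site (F.P K) 0) (ρ S M Nr : ℕ) (hM : 1 ≤ M) (hS : 2 ≤ S) (hNr : M ≤ Nr)
    (hroom : 2 * ρ + Nr ≤ F.L ^ (F.m + n))
    {a : LSite (F.P K).d} {M' ρ' : ℕ} (hρ' : 2 ≤ ρ') (h0 : ρ + M ≤ ρ' + 1) (h1 : (F.P K).L + S + M ≤ ρ' + 2)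
    (ha : ∀ ν, a ν ≤ ((iterBlockOf (K - n) x₀ ν).val : ℤ) ∧ ((iterBlockOf (K - n) x₀ ν).val : ℤ) ≤ a ν + M' - 1)
    (hroomW : 2 * ((F.P K).L ^ (K - n) * (M' + 1) + ρ' * gs (F.P K).L (K - n)) ≤ (F.P K).sitesPerDir 0)
    (U : GaugeField (F.P K) 0 (Matrix.specialUnitaryGroup (Fin 2) ℂ)) {ε₀ B₁ : ℝ} (hε₀ : 0 < ε₀) (hε : 10 ^ 7 * (F.L : ℝ) ^ 3 * ε₀ ≤ 1)
    (hU : PlaqSmall (regThreshold F n K ε₀) U)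
    (w : LSite (F.P K).d → Matrix.specialUnitaryGroup (Fin 2) ℂ) (X : LSite (F.P K).d → Fin (F.P K).d → Matrix (Fin 2) (Fin 2) ℂ)
    (μ : ℕ → LSite (F.P K).d → Matrix (Fin 2) (Fin 2) ℂ)
    (hWnear : ∀ z ∈ cube (F.P K).L a M' ρ' (K - n) 0, ∀ ν : Fin (F.P K).d,
      transl (0 : Site (F.P K) 0) z ∈ cubeSetM x₀ (K - n) ρ S M 0 → (transl (0 : Site (F.P K) 0) z).shift ν ∈ cubeSetM x₀ (K - n) ρ S M 0 →
      ‖(((Unitary.toUnits (suIncl (w z)))⁻¹ * unitsField (toUField U) ⟨transl 0 z, ν⟩ * Unitary.toUnits (suIncl (w (z + e ν))) :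
          (Matrix (Fin 2) (Fin 2) ℂ)ˣ) : Matrix (Fin 2) (Fin 2) ℂ) - 1‖ ≤ 1 / 4)
    (hX : ∀ z ∈ cube (F.P K).L a M' ρ' (K - n) 0, ∀ ν : Fin (F.P K).d,
      transl (0 : Site (F.P K) 0) z ∈ cubeSetM x₀ (K - n) ρ S M 0 → (transl (0 : Site (F.P K) 0) z).shift ν ∈ cubeSetM x₀ (K - n) ρ S M 0 →
      I • ((((F.L : ℝ)⁻¹) ^ (K - n)) • X z ν) = mlog (((Unitary.toUnits (suIncl (w z)))⁻¹ * unitsField (toUField U) ⟨transl 0 z, ν⟩ *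
          Unitary.toUnits (suIncl (w (z + e ν))) : (Matrix (Fin 2) (Fin 2) ℂ)ˣ) : Matrix (Fin 2) (Fin 2) ℂ))
    (hLan : ∀ z ∈ cube (F.P K).L a M' ρ' (K - n) 0,
      covLap (((F.L : ℝ)⁻¹) ^ (K - n)) (1 : LSite (F.P K).d → Fin (F.P K).d → (Matrix (Fin 2) (Fin 2) ℂ)ˣ)
          ((cube (F.P K).L a M' ρ' (K - n) 0).indicator
            (covDivB (((F.L : ℝ)⁻¹) ^ (K - n)) (1 : LSite (F.P K).d → Fin (F.P K).d → (Matrix (Fin 2) (Fin 2) ℂ)ˣ) X)) z =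
        QT (F.P K).L (K - n) (cubeLamS (F.P K).L a M' ρ' (K - n) (K - n)) (1 : LSite (F.P K).d → Fin (F.P K).d → (Matrix (Fin 2) (Fin 2) ℂ)ˣ) μ z)
    (g h' : GaugeTransf (F.P K) 0 (Matrix (Fin 2) (Fin 2) ℂ)ˣ)
    (κ' : (i : ℕ) → GaugeTransf (F.P K) i (Matrix (Fin 2) (Fin 2) ℂ)ˣ) (h0' : κ' 0 = h')
    (hs' : ∀ (i : ℕ) (y : Site (F.P K) (i + 1)),
      κ' (i + 1) y = (vframeU (gaugeActT (κ' i) (dbarIterU i (gaugeActT g (unitsField (toUField U))))) y)⁻¹ * κ' i (emb y) *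
        vframeU (dbarIterU i (gaugeActT g (unitsField (toUField U)))) y)
    (ν : (i : ℕ) → Site (F.P K) i → (Matrix (Fin 2) (Fin 2) ℂ)ˣ) (hν0 : ∀ s, ν 0 s = 1)
    (hνs : ∀ (i : ℕ) (y : Site (F.P K) (i + 1)),
      ν (i + 1) y = ν i (emb y) * vframeU (dbarIterU i (gaugeActT g (unitsField (toUField U)))) y)
    (gs' : (i : ℕ) → GaugeTransf (F.P K) i (Matrix (Fin 2) (Fin 2) ℂ)ˣ) (hg0 : gs' 0 = g)
    (hgs : ∀ (i : ℕ) (y : Site (F.P K) (i + 1)), gs' (i + 1) y = gs' i (emb y))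
    (hug : ∀ s, (Unitary.toUnits (suIncl (w (lift (F.P K) x₀ + rel x₀ s))))⁻¹ =
      ((gs' (K - n) (iterBlockOf (K - n) x₀))⁻¹ * ν (K - n) (iterBlockOf (K - n) x₀)) * h' s * g s)
    (htop : ∀ yc ∈ cubeLamS (F.P K).L a M' ρ' (K - n) (K - n) (K - n),
      κ' (K - n) (coverAt (F.P K) (K - n) yc) =
        axialT (dbarIterU (K - n) (gaugeActT g (unitsField (toUField U)))) (iterBlockOf (K - n) x₀) (coverAt (F.P K) (K - n) yc))
    (hsize : ∀ wt : ℕ → PBond (F.P K) 0 → ℝ, IsLevWeight F n K (cubeSeqMT3 F n K x₀ ρ S M hM) wt →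
      (∀ b : PBond (F.P K) 0, wt 1 b *
        ‖(fun b : PBond (F.P K) 0 => if b.src ∈ cubeSetM x₀ (K - n) ρ S M 0 ∧ b.tgt ∈ cubeSetM x₀ (K - n) ρ S M 0 then
          X (lift (F.P K) x₀ + rel x₀ b.src) b.dir else 0) b‖ ≤ B₁ * ε₀) ∧
      (∀ (b : PBond (F.P K) 0) (ν' : Fin (F.P K).d), wt 2 b * (F.L : ℝ) ^ (K - n) *
        ‖(fun b : PBond (F.P K) 0 => if b.src ∈ cubeSetM x₀ (K - n) ρ S M 0 ∧ b.tgt ∈ cubeSetM x₀ (K - n) ρ S M 0 then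
            X (lift (F.P K) x₀ + rel x₀ b.src) b.dir else 0) ⟨b.src.shift ν', b.dir⟩ -
          (fun b : PBond (F.P K) 0 => if b.src ∈ cubeSetM x₀ (K - n) ρ S M 0 ∧ b.tgt ∈ cubeSetM x₀ (K - n) ρ S M 0 then
            X (lift (F.P K) x₀ + rel x₀ b.src) b.dir else 0) b‖ ≤ B₁ * ε₀)) :
    ∃ (u : GaugeTransf (F.P K) 0 (Matrix.specialUnitaryGroup (Fin 2) ℂ)) (A : PBond (F.P K) 0 → Matrix (Fin 2) (Fin 2) ℂ),
      DP1Clause F n K (cubeSeqMT3 F n K x₀ ρ S M hM) x₀ U (fun s => suIncl (u s)) ∧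
      (∀ (z : LSite (F.P K).d) (μ : Fin (F.P K).d), transl (0 : Site (F.P K) 0) z ∈ cubeSetM x₀ (K - n) ρ S M 0 →
        (transl (0 : Site (F.P K) 0) z).shift μ ∈ cubeSetM x₀ (K - n) ρ S M 0 →
        ‖(((Unitary.toUnits (suIncl (u (transl 0 z))))⁻¹ * unitsField (toUField U) ⟨transl 0 z, μ⟩ *
            Unitary.toUnits (suIncl (u ((transl 0 z).shift μ))) : (Matrix (Fin 2) (Fin 2) ℂ)ˣ) : Matrix (Fin 2) (Fin 2) ℂ) - 1‖ ≤ 1 / 4) ∧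
      (∀ (z : LSite (F.P K).d) (μ : Fin (F.P K).d), transl (0 : Site (F.P K) 0) z ∈ cubeSetM x₀ (K - n) ρ S M 0 →
        (transl (0 : Site (F.P K) 0) z).shift μ ∈ cubeSetM x₀ (K - n) ρ S M 0 →
        I • ((((F.L : ℝ)⁻¹) ^ (K - n)) • A ⟨transl 0 z, μ⟩) =
          mlog (((Unitary.toUnits (suIncl (u (transl 0 z))))⁻¹ * unitsField (toUField U) ⟨transl 0 z, μ⟩ *
            Unitary.toUnits (suIncl (u ((transl 0 z).shift μ))) : (Matrix (Fin 2) (Fin 2) ℂ)ˣ) : Matrix (Fin 2) (Fin 2) ℂ)) ∧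
      (∀ b : PBond (F.P K) 0, ¬ (∃ z : LSite (F.P K).d, transl (0 : Site (F.P K) 0) z ∈ cubeSetM x₀ (K - n) ρ S M 0 ∧
        (transl (0 : Site (F.P K) 0) z).shift b.dir ∈ cubeSetM x₀ (K - n) ρ S M 0 ∧ b = ⟨transl 0 z, b.dir⟩) → A b = 0) ∧
      (∀ wt : ℕ → PBond (F.P K) 0 → ℝ, IsLevWeight F n K (cubeSeqMT3 F n K x₀ ρ S M hM) wt →
        (∀ b : PBond (F.P K) 0, wt 1 b * ‖A b‖ ≤ B₁ * ε₀) ∧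
        (∀ (b : PBond (F.P K) 0) (ν' : Fin (F.P K).d), wt 2 b * (F.L : ℝ) ^ (K - n) * ‖A ⟨b.src.shift ν', b.dir⟩ - A b‖ ≤ B₁ * ε₀)) ∧
      (∃ μ' : SiteIdx (cubeSeqMT3 F n K x₀ ρ S M hM) → Matrix (Fin 2) (Fin 2) ℂ, ∀ s : Site (F.P K) 0,
        laplace ((F.L : ℝ) ^ (K - n)) (diverg ((F.L : ℝ) ^ (K - n)) A) s =
          ∑ i : SiteIdx (cubeSeqMT3 F n K x₀ ρ S M hM), siteAvgIter (i.1.1 : ℕ) (Pi.single s (1 : ℝ)) i.1.2 • μ' i) := by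
  have hL : 1 ≤ (F.P K).L := (F.P K).L_pos
  refine mlogChartDataMult_of_suppliers hnK x₀ ρ S M Nr hM hS hNr hroom hρ' h0 h1 ha hroomW U hε₀ hε hU w X
    (cubeLamS (F.P K).L a M' ρ' (K - n) (K - n)) μ hWnear hX hLan ?_ ?_ g h' κ' h0' hs' ν hν0 hνs gs' hg0 hgs hug htop hsize
  · -- (R2)'s tower exclusion at N05's tower
    intro j _ hjk j' hj' z hz
    rw [cubeLamS_top (F.P K).L a M' ρ' (show j' ≤ K - n by omega)]
    exact flm_not_mem_cubeLam_of_mem_cube hL hj' hjk hz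
  · -- (R3)'s top box IS `Λs k`
    intro yc h
    rw [cubeLamS_self]
    exact h

end Summit.QuantumFields.YangMills.Theorems.HalvingP1FlatCoreChartDataDoor

end
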